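import Summits.AnomalousDissipation.AnomalousDissipation.Theorems.UniformResolution.Negative.FGTBound
import Summits.AnomalousDissipation.AnomalousDissipation.Theorems.UniformResolution.Negative.ShearLaw

/-!
# Negative knowledge for the crux `UniformResolution` (stmt-AnomalousDissipation-14330), X-a:
# the ROW BARRIER, part 1 — shear atoms (both rows are explicit scalars), weighted atomic laws, the barrier's weights

Standing disprover, generation 2 (refuter-cdisprove-stmt-AnomalousDissipation-14330-g2-0, cycle 1). Supports
stmt-AnomalousDissipation-14330 (`QuarticLadder.UniformResolution` ≡ `MomentParity.UniformResolution`); no route-item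
statement is asserted. The atom calculus and the real arithmetic of the barrier `Negative/RowBarrier.lean`:
* a shear state `[S_{M,a}]` (`ShearMode.shearState`, no self-advection) at any level `n ≥ M`: coefficients, `P_n`-truncation,
  `−ΔP_n`, enstrophy `2π²M²a²`, palinstrophy `8π⁴M⁴a²`, FGT weight, and at the shear force `S_{1,c}` the ENERGY ROW
  `⟨F(U), ū⟩ = [M=1]ca/2 − 2π²νM²a²`, the plain ENSTROPHY ROW `= 4π²M² ×` (energy row) and the FGT integrand;
* weighted atomic laws `atomic w U = Σᵢ wᵢ δ_{Uᵢ}`; the weights `w_A, w_C, w_B, e_m`, masses `p_A, p_C, p_B, p_0` of the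
  leak laws, their signs (from `9 < π² < 16`) and the solved system `4p_A − 5p_C = 2`, `4p_A w_A − 5p_C w_C = 2e_m`.
-/

namespace Summit.AnomalousDissipation.AnomalousDissipation.Theorems.UniformResolution.Negative

open MeasureTheory Filter Topology
open scoped ENNReal InnerProductSpace RealInnerProductSpace
open Literature.Analysis.FunctionSpaces Literature.Analysis.FluidPDE
open Summit.AnomalousDissipation.AnomalousDissipation.Theorems.QuarticGate.Negative
open Summit.AnomalousDissipation.AnomalousDissipation.Theorems
open Summit.AnomalousDissipation.AnomalousDissipation.Theorems.ResolvedDissipation.Negative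
  (shearFreq shearSet shearField shearState shearField_mul shearField_zero neg_mem_shearSet freqNormSq_of_mem_shearSet
    ne_zero_of_mem_shearSet card_shearSet isSmooth_shearField isDivFree_shearField hasZeroMean_shearField
    convect_shearField_self coe_shearState_ae isLevel_shearState norm_sq_shearState eGradNormSq_shearState
    eGradNormSq_fourierTruncate_shearState mFourierCoeff_shearField_eq_zero integral_norm_sq_shearField
    isTransversal_kolCoeff_shearSet fourierTruncate_shearField eGradNormSq_zero fourierTruncate_congr_ae)

noncomputable section

/-- Local notation for the real Hilbert space `L²(T³; ℝ³)`. -/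
local notation "L2T3" => Lp (EuclideanSpace ℝ (Fin 3)) 2 (volume : Measure (UnitAddTorus (Fin 3)))

/-! ## 1. Single-shell shear atoms: coefficients, truncations, enstrophy, palinstrophy, the two rows -/

section Atoms

variable {M n : ℕ} (hM : M ≠ 0) (a : ℝ)

/-- `realTrigPoly` over a larger frequency set with vanishing extra coefficients. [folklore] -/
theorem realTrigPoly_subset {S S' : Finset (Fin 3 → ℤ)} (hSS' : S ⊆ S') {c : (Fin 3 → ℤ) → EuclideanSpace ℂ (Fin 3)}
    (h : ∀ k ∈ S', k ∉ S → c k = 0) : Torus.realTrigPoly S' c = Torus.realTrigPoly S c := by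
  rw [Torus.realTrigPoly_eq_comp, Torus.realTrigPoly_eq_comp, Torus.trigPoly_subset hSS' h]

/-- The shear shell sits in the ball of every level `n ≥ M`. [folklore] -/
theorem shearSet_subset_freqBall (hMn : M ≤ n) : shearSet M ⊆ Torus.freqBall n := fun k hk =>
  Torus.mem_freqBall.2 (by
    rw [freqNormSq_of_mem_shearSet hk]
    exact_mod_cast Nat.pow_le_pow_left hMn 2)

/-- Fourier coefficients of the shear state: `kolCoeff a` on the shell, `0` off it. [folklore] -/
theorem coef_shearState (k : Fin 3 → ℤ) :
    coef (shearState M hM a) k = if k ∈ shearSet M then kolCoeff a k else 0 := by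
  unfold coef
  rw [mFourierCoeff_congr_ae (coe_shearState_ae hM a)]
  exact Torus.mFourierCoeff_realTrigPoly (neg_mem_shearSet M) (isConjSymm_kolCoeff a) k

/-- The level-`n` truncation of the shear state IS the shear field (`M ≤ n`). [folklore] -/
theorem trunc_shearState (hMn : M ≤ n) : trunc n (shearState M hM a) = shearField M a := by
  rw [trunc_eq, realTrigPoly_subset (shearSet_subset_freqBall hMn) (c := coef (shearState M hM a))
    (fun k _ hk => by rw [coef_shearState, if_neg hk])]
  exact Torus.realTrigPoly_congr fun k hk => by rw [coef_shearState, if_pos hk]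

/-- `−Δ` of the truncation of the shear state is the shear field with amplitude `4π²M²a`. [folklore] -/
theorem lapTrunc_shearState (hMn : M ≤ n) :
    lapTrunc n (shearState M hM a) = shearField M (4 * Real.pi ^ 2 * (M : ℝ) ^ 2 * a) := by
  have hcoef : ∀ k, lapCoef (shearState M hM a) k =
      if k ∈ shearSet M then kolCoeff (4 * Real.pi ^ 2 * (M : ℝ) ^ 2 * a) k else 0 := by
    intro k
    simp only [lapCoef, coef_shearState]
    split_ifs with hk
    · rw [freqNormSq_of_mem_shearSet hk, kolCoeff_mul]
    · rw [smul_zero]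
  unfold lapTrunc
  rw [realTrigPoly_subset (shearSet_subset_freqBall hMn) (c := lapCoef (shearState M hM a))
    (fun k _ hk => by rw [hcoef, if_neg hk])]
  exact Torus.realTrigPoly_congr fun k hk => by rw [hcoef, if_pos hk]

/-- The weighted coefficient sums of a shear state over any ball containing its shell. [folklore] -/
theorem sum_freqBall_coef_shearState (hMn : M ≤ n) (φ : ℝ → ℝ) :
    ∑ k ∈ Torus.freqBall n, φ (Torus.freqNormSq k) * ‖coef (shearState M hM a) k‖ ^ 2 =
      2 * (φ ((M : ℝ) ^ 2) * (a ^ 2 / 4)) := by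
  rw [← Finset.sum_subset (shearSet_subset_freqBall hMn) fun k _ hk => by
    rw [coef_shearState, if_neg hk, norm_zero]; ring]
  rw [Finset.sum_congr rfl fun k hk => by
    rw [coef_shearState, if_pos hk, freqNormSq_of_mem_shearSet hk, norm_kolCoeff], Finset.sum_const, card_shearSet hM]
  simp only [nsmul_eq_mul, Nat.cast_ofNat, div_pow, sq_abs]
  ring

/-- Enstrophy of the shear atom: `G = 2π²M²a²`. [folklore] -/
theorem gradSq_shearState (hMn : M ≤ n) : gradSq n (shearState M hM a) = 2 * Real.pi ^ 2 * (M : ℝ) ^ 2 * a ^ 2 := by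
  unfold gradSq
  rw [sum_freqBall_coef_shearState hM a hMn (fun t => t)]
  ring

/-- Palinstrophy of the shear atom: `‖Δū‖² = 8π⁴M⁴a²`. [folklore] -/
theorem lapSq_shearState (hMn : M ≤ n) : lapSq n (shearState M hM a) = 8 * Real.pi ^ 4 * (M : ℝ) ^ 4 * a ^ 2 := by
  unfold lapSq
  rw [sum_freqBall_coef_shearState hM a hMn (fun t => t ^ 2)]
  ring

/-- The FGT weight of the shear atom. [folklore] -/
theorem fgtWeight_shearState (hMn : M ≤ n) :
    fgtWeight n (shearState M hM a) = ((1 + 2 * Real.pi ^ 2 * (M : ℝ) ^ 2 * a ^ 2) ^ 4)⁻¹ := by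
  rw [fgtWeight, gradSq_shearState hM a hMn]

/-- Shear fields on the same shell: `∫⟪S_{M,c}, S_{M,b}⟫ = cb/2`. [folklore] -/
theorem integral_inner_shearField_same (hM : M ≠ 0) (c b : ℝ) :
    ∫ x, ⟪shearField M c x, shearField M b x⟫_ℝ = c * b / 2 := by
  have h1 : ∀ x, ⟪shearField M c x, shearField M b x⟫_ℝ = (c * b) * ‖shearField M 1 x‖ ^ 2 := fun x => by
    rw [show c = c * 1 by ring, shearField_mul, show b = b * 1 by ring, shearField_mul, inner_smul_left,
      inner_smul_right, real_inner_self_eq_norm_sq]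
    simp only [mul_one, RCLike.conj_to_real]
    ring
  simp_rw [h1]
  rw [integral_const_mul, integral_norm_sq_shearField hM]
  ring

/-- Shear fields on different shells are orthogonal. [folklore] -/
theorem integral_inner_shearField_of_ne {M M' : ℕ} (hMM' : M ≠ M') (c b : ℝ) :
    ∫ x, ⟪shearField M c x, shearField M' b x⟫_ℝ = 0 := by
  rw [shearField, Torus.integral_inner_realTrigPoly_left (neg_mem_shearSet M) (isConjSymm_kolCoeff c)
    ((isSmooth_shearField M' b).memLp 2)]
  refine Finset.sum_eq_zero fun k hk => ?_
  have hk' : k ∉ shearSet M' := fun hk' => hMM' (by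
    have h1 := freqNormSq_of_mem_shearSet hk
    rw [freqNormSq_of_mem_shearSet hk'] at h1
    exact_mod_cast (sq_eq_sq₀ (Nat.cast_nonneg M') (Nat.cast_nonneg M)).1 h1 |>.symm)
  change (inner ℂ (kolCoeff c k) (UnitAddTorus.mFourierCoeff (EuclideanSpace.complexify ∘ shearField M' b) k)).re = 0
  rw [mFourierCoeff_shearField_eq_zero b hk', inner_zero_right, Complex.zero_re]

/-- `∫⟪S_{1,c}, S_{M,b}⟫ = cb/2` if `M = 1`, else `0`. [folklore] -/
theorem integral_inner_shearField_one (c b : ℝ) :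
    ∫ x, ⟪shearField 1 c x, shearField M b x⟫_ℝ = if M = 1 then c * b / 2 else 0 := by
  split_ifs with h
  · subst h; exact integral_inner_shearField_same one_ne_zero c b
  · exact integral_inner_shearField_of_ne (Ne.symm h) c b

variable {ν : ℝ}

/-- **THE ENERGY ROW OF A SHEAR ATOM** at force `S_{1,c}`: `⟨F(U), ū⟩ = [M = 1] ca/2 − 2π²νM²a²`. [folklore] -/
theorem energyRow_shearState (ν c : ℝ) (hMn : M ≤ n) :
    Torus.nsGeneratorPairing ν (shearField 1 c) (shearState M hM a) (trunc n (shearState M hM a)) =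
      (if M = 1 then c * a / 2 else 0) - ν * (2 * Real.pi ^ 2 * (M : ℝ) ^ 2 * a ^ 2) := by
  rw [nsGeneratorPairing_trunc_eq ν (isSmooth_shearField 1 c) (isLevel_shearState hM a hMn)]
  change (∫ x, ⟪shearField 1 c x, trunc n (shearState M hM a) x⟫_ℝ) - ν * gradSq n (shearState M hM a) = _
  rw [trunc_shearState hM a hMn, integral_inner_shearField_one, gradSq_shearState hM a hMn]

/-- **THE ENSTROPHY-TEST ROW OF A SHEAR ATOM** (test field `z = −Δū`, no stretching): `⟨F(U), z⟩ = 4π²M² ⟨F(U), ū⟩`.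
[folklore] -/
theorem enstrophyRow_shearState (ν c : ℝ) (hMn : M ≤ n) :
    Torus.nsGeneratorPairing ν (shearField 1 c) (shearState M hM a) (lapTrunc n (shearState M hM a)) =
      4 * Real.pi ^ 2 * (M : ℝ) ^ 2 * ((if M = 1 then c * a / 2 else 0) - ν * (2 * Real.pi ^ 2 * (M : ℝ) ^ 2 * a ^ 2)) := by
  rw [nsGeneratorPairing_lapTrunc_eq ν (isSmooth_shearField 1 c) (isLevel_shearState hM a hMn), ← lapSq_eq,
    lapSq_shearState hM a hMn, trunc_shearState hM a hMn, lapTrunc_shearState hM a hMn, integral_inner_shearField_one]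
  simp_rw [convect_shearField_self, inner_zero_left, integral_zero]
  split_ifs <;> ring

/-- **THE FGT INTEGRAND OF A SHEAR ATOM**: `(1+G)⁻⁴⟨F(U), z⟩`, explicitly. [folklore] -/
theorem fgtRow_shearState (ν c : ℝ) (hMn : M ≤ n) :
    fgtWeight n (shearState M hM a) *
        Torus.nsGeneratorPairing ν (shearField 1 c) (shearState M hM a) (lapTrunc n (shearState M hM a)) =
      ((1 + 2 * Real.pi ^ 2 * (M : ℝ) ^ 2 * a ^ 2) ^ 4)⁻¹ *
        (4 * Real.pi ^ 2 * (M : ℝ) ^ 2 * ((if M = 1 then c * a / 2 else 0) - ν * (2 * Real.pi ^ 2 * (M : ℝ) ^ 2 * a ^ 2))) := by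
  rw [fgtWeight_shearState hM a hMn, enstrophyRow_shearState hM a ν c hMn]

end Atoms

/-! ## 2. Weighted atomic laws on `H` (finitely many Dirac masses with real weights) -/

section Atomic

variable {ι : Type*} [Fintype ι] (w : ι → ℝ) (U : ι → Torus.energySpace (Fin 3))

/-- The weighted atomic law `Σᵢ wᵢ δ_{Uᵢ}` (weights entered through `ENNReal.ofReal`). -/
def atomic : Measure (Torus.energySpace (Fin 3)) :=
  ∑ i, ENNReal.ofReal (w i) • Measure.dirac (U i)

/-- Lower Lebesgue integrals against a weighted atomic law. [folklore] -/
theorem lintegral_atomic (G : Torus.energySpace (Fin 3) → ℝ≥0∞) :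
    ∫⁻ u, G u ∂(atomic w U) = ∑ i, ENNReal.ofReal (w i) * G (U i) := by
  haveI : MeasurableSingletonClass (Torus.energySpace (Fin 3)) := OpensMeasurableSpace.toMeasurableSingletonClass
  rw [atomic, lintegral_finsetSum_measure]
  exact Finset.sum_congr rfl fun i _ => by rw [lintegral_smul_measure, lintegral_dirac, smul_eq_mul]

/-- Every real observable is integrable against a weighted atomic law. [folklore] -/
theorem integrable_atomic (F : Torus.energySpace (Fin 3) → ℝ) : Integrable F (atomic w U) := by
  rw [atomic, integrable_finsetSum_measure]
  exact fun i _ => (Torus.integrable_dirac _ _).smul_measure ENNReal.ofReal_ne_top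

/-- Bochner integrals against a weighted atomic law with nonnegative weights. [folklore] -/
theorem integral_atomic (hw : ∀ i, 0 ≤ w i) (F : Torus.energySpace (Fin 3) → ℝ) :
    ∫ u, F u ∂(atomic w U) = ∑ i, w i * F (U i) := by
  haveI : MeasurableSingletonClass (Torus.energySpace (Fin 3)) := OpensMeasurableSpace.toMeasurableSingletonClass
  rw [atomic, integral_finsetSum_measure fun i _ => (Torus.integrable_dirac _ _).smul_measure ENNReal.ofReal_ne_top]
  exact Finset.sum_congr rfl fun i _ => by
    rw [integral_smul_measure, integral_dirac, ENNReal.toReal_ofReal (hw i), smul_eq_mul]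

/-- Almost-sure statements for a weighted atomic law: it suffices to check the atoms. [folklore] -/
theorem ae_atomic {p : Torus.energySpace (Fin 3) → Prop} (h : ∀ i, p (U i)) : ∀ᵐ u ∂(atomic w U), p u := by
  haveI : MeasurableSingletonClass (Torus.energySpace (Fin 3)) := OpensMeasurableSpace.toMeasurableSingletonClass
  rw [atomic, ae_finsetSum_measure_iff]
  intro i _
  refine Measure.ae_smul_measure ?_ _
  rw [ae_dirac_eq]
  exact h i

/-- Total mass of a weighted atomic law with nonnegative weights summing to one. [folklore] -/
theorem isProbabilityMeasure_atomic (hw : ∀ i, 0 ≤ w i) (hsum : ∑ i, w i = 1) :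
    IsProbabilityMeasure (atomic w U) := by
  refine ⟨?_⟩
  have h := lintegral_atomic w U (fun _ => 1)
  simp only [lintegral_one, mul_one] at h
  rw [h, ← ENNReal.ofReal_sum_of_nonneg fun i _ => hw i, hsum, ENNReal.ofReal_one]

/-- Mean energy of a weighted atomic law. [folklore] -/
theorem ensembleEnergy_atomic (hw : ∀ i, 0 ≤ w i) :
    Torus.ensembleEnergy (atomic w U) = ∑ i, w i * ‖U i‖ ^ 2 :=
  integral_atomic w U hw _

/-- Mean enstrophy of a weighted atomic law. [folklore] -/
theorem ensembleEnstrophy_atomic :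
    Torus.ensembleEnstrophy (atomic w U) =
      ∑ i, ENNReal.ofReal (w i) * Torus.eGradNormSq (((U i).1 : L2T3) : UnitAddTorus (Fin 3) → EuclideanSpace ℝ (Fin 3)) :=
  lintegral_atomic w U _

end Atomic

/-! ## 3. The weights and masses of the leak laws (pure real arithmetic) -/

section Weights

/-- FGT weight of the production atom `[S_{1,1/2}]` (`G = π²/2`). -/
def wA : ℝ := ((1 + Real.pi ^ 2 / 2) ^ 4)⁻¹

/-- FGT weight of the low consumption atom `[S_{1,−1/4}]` (`G = π²/8`). -/
def wC : ℝ := ((1 + Real.pi ^ 2 / 8) ^ 4)⁻¹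

/-- FGT weight of the cutoff atom `[S_{m+2,1}]` (`G = 2π²(m+2)²`). -/
def wB (m : ℕ) : ℝ := ((1 + 2 * Real.pi ^ 2 * ((m + 2 : ℕ) : ℝ) ^ 2) ^ 4)⁻¹

/-- The (vanishing) weighted palinstrophy defect of the cutoff atom: `e_m = (m+2)² w_B`. -/
def leakE (m : ℕ) : ℝ := ((m + 2 : ℕ) : ℝ) ^ 2 * wB m

/-- Mass of the low consumption atom: `p_C = 2(w_A − e_m)/(5(w_C − w_A))`. -/
def leakMassC (m : ℕ) : ℝ := 2 * (wA - leakE m) / (5 * (wC - wA))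

/-- Mass of the production atom: `p_A = 1/2 + (5/4) p_C`. -/
def leakMassA (m : ℕ) : ℝ := 1 / 2 + 5 / 4 * leakMassC m

/-- Mass of the cutoff atom: `(8(m+2)²)⁻¹`. -/
def leakMassB (m : ℕ) : ℝ := (8 * ((m + 2 : ℕ) : ℝ) ^ 2)⁻¹

/-- Mass of the null atom (the rest). -/
def leakMass0 (m : ℕ) : ℝ := 1 - leakMassA m - leakMassC m - leakMassB m

/-- The four weights, indexed. -/
def leakWeight (m : ℕ) : Fin 4 → ℝ := ![leakMassA m, leakMassC m, leakMassB m, leakMass0 m]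

/-! ### Elementary inequalities between the weights -/

/-- `9 < π²`. [folklore] -/
theorem pi_sq_gt_nine : 9 < Real.pi ^ 2 := by nlinarith [Real.pi_gt_three]

/-- `π² < 16`. [folklore] -/
theorem pi_sq_lt_sixteen : Real.pi ^ 2 < 16 := by nlinarith [Real.pi_lt_four, Real.pi_pos]

/-- `0 < w_A`. [folklore] -/
theorem wA_pos : 0 < wA := by unfold wA; positivity

/-- `0 < w_C`. [folklore] -/
theorem wC_pos : 0 < wC := by unfold wC; positivity

/-- `0 < w_B`. [folklore] -/
theorem wB_pos (m : ℕ) : 0 < wB m := by unfold wB; positivity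

/-- `w_C ≥ 3 w_A` (the low consumer sits at lower enstrophy than the producer). [folklore] -/
theorem three_mul_wA_le_wC : 3 * wA ≤ wC := by
  have h9 := pi_sq_gt_nine
  have h16 := pi_sq_lt_sixteen
  unfold wA wC
  have hC : (1 + Real.pi ^ 2 / 8) ^ 4 ≤ 81 := by
    have h1 : 1 + Real.pi ^ 2 / 8 ≤ 3 := by linarith
    have h0 : 0 ≤ 1 + Real.pi ^ 2 / 8 := by positivity
    calc (1 + Real.pi ^ 2 / 8) ^ 4 ≤ 3 ^ 4 := pow_le_pow_left₀ h0 h1 4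
      _ = 81 := by norm_num
  have hA : (915 : ℝ) ≤ (1 + Real.pi ^ 2 / 2) ^ 4 := by
    have h1 : (11 / 2 : ℝ) ≤ 1 + Real.pi ^ 2 / 2 := by linarith
    calc (915 : ℝ) ≤ (11 / 2) ^ 4 := by norm_num
      _ ≤ (1 + Real.pi ^ 2 / 2) ^ 4 := pow_le_pow_left₀ (by norm_num) h1 4
  have hCpos : 0 < (1 + Real.pi ^ 2 / 8) ^ 4 := by positivity
  rw [show 3 * ((1 + Real.pi ^ 2 / 2) ^ 4)⁻¹ = 3 / (1 + Real.pi ^ 2 / 2) ^ 4 by ring, inv_eq_one_div,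
    div_le_div_iff₀ (by positivity) hCpos]
  nlinarith

/-- `w_A < w_C`. [folklore] -/
theorem wA_lt_wC : wA < wC := by linarith [three_mul_wA_le_wC, wA_pos]

/-- The cutoff defect is below the producer's weight: `e_m < w_A` (so `p_C > 0`). [folklore] -/
theorem leakE_lt_wA (m : ℕ) : leakE m < wA := by
  have h9 := pi_sq_gt_nine
  unfold leakE wB wA
  set x : ℝ := Real.pi ^ 2 with hx
  set N : ℝ := ((m + 2 : ℕ) : ℝ) with hN
  have hN1 : (1 : ℝ) ≤ N := by rw [hN]; exact_mod_cast Nat.le_add_left 1 (m + 1)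
  have hN2 : 1 ≤ N ^ 2 := one_le_pow₀ hN1
  rw [← div_eq_mul_inv, inv_eq_one_div, div_lt_div_iff₀ (by positivity) (by positivity), one_mul]
  -- `N²(1+x/2)⁴ < (2x)⁴ N² ≤ (2x N²)⁴ ≤ (1 + 2xN²)⁴`
  have h1 : (1 + x / 2) ^ 4 < (2 * x) ^ 4 :=
    pow_lt_pow_left₀ (by linarith) (by positivity) (by norm_num)
  have h2 : N ^ 2 * (2 * x) ^ 4 ≤ (2 * x * N ^ 2) ^ 4 := by
    have : N ^ 2 ≤ (N ^ 2) ^ 4 := by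
      calc N ^ 2 = (N ^ 2) ^ 1 := (pow_one _).symm
        _ ≤ (N ^ 2) ^ 4 := pow_le_pow_right₀ hN2 (by norm_num)
    nlinarith [pow_pos (show (0:ℝ) < 2 * x by positivity) 4]
  have h3 : (2 * x * N ^ 2) ^ 4 ≤ (1 + 2 * x * N ^ 2) ^ 4 :=
    pow_le_pow_left₀ (by positivity) (by linarith) 4
  calc N ^ 2 * (1 + x / 2) ^ 4 < N ^ 2 * (2 * x) ^ 4 := by gcongr
    _ ≤ (1 + 2 * x * N ^ 2) ^ 4 := h2.trans h3

/-- `0 < e_m`. [folklore] -/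
theorem leakE_pos (m : ℕ) : 0 < leakE m := by unfold leakE; have := wB_pos m; positivity

/-- `0 < p_C`. [folklore] -/
theorem leakMassC_pos (m : ℕ) : 0 < leakMassC m := by
  unfold leakMassC
  have := leakE_lt_wA m
  have := wA_lt_wC
  exact div_pos (by linarith) (by linarith)

/-- `p_C ≤ 1/5`. [folklore] -/
theorem leakMassC_le (m : ℕ) : leakMassC m ≤ 1 / 5 := by
  unfold leakMassC
  have h1 := leakE_pos m
  have h2 := three_mul_wA_le_wC
  have h3 := wA_pos
  rw [div_le_div_iff₀ (by linarith) (by norm_num)]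
  nlinarith

/-- `0 < p_A`. [folklore] -/
theorem leakMassA_pos (m : ℕ) : 0 < leakMassA m := by
  unfold leakMassA; have := leakMassC_pos m; positivity

/-- `0 < p_B`. [folklore] -/
theorem leakMassB_pos (m : ℕ) : 0 < leakMassB m := by unfold leakMassB; positivity

/-- `(8(m+2)²)⁻¹ ≤ 1/32`. [folklore] -/
theorem leakMassB_le (m : ℕ) : leakMassB m ≤ 1 / 32 := by
  unfold leakMassB
  have hN : (2 : ℝ) ≤ ((m + 2 : ℕ) : ℝ) := by exact_mod_cast Nat.le_add_left 2 m
  rw [inv_eq_one_div, div_le_div_iff₀ (by positivity) (by norm_num)]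
  nlinarith

/-- `0 ≤ p_0` (total mass of the three charged atoms is `< 1`). [folklore] -/
theorem leakMass0_nonneg (m : ℕ) : 0 ≤ leakMass0 m := by
  unfold leakMass0 leakMassA
  have h1 := leakMassC_le m
  have h2 := leakMassB_le m
  linarith

/-- All four weights are nonnegative. [folklore] -/
theorem leakWeight_nonneg (m : ℕ) : ∀ i, 0 ≤ leakWeight m i := by
  intro i
  fin_cases i
  · exact (leakMassA_pos m).le
  · exact (leakMassC_pos m).le
  · exact (leakMassB_pos m).le
  · exact leakMass0_nonneg m

/-- The four weights sum to one. [folklore] -/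
theorem sum_leakWeight (m : ℕ) : ∑ i, leakWeight m i = 1 := by
  simp only [leakWeight, Fin.sum_univ_four, Matrix.cons_val_zero, Matrix.cons_val_one, Matrix.cons_val]
  unfold leakMass0
  ring

/-- **The two-row system, solved**: `4p_A − 5p_C = 2` (energy row) and `4p_A w_A − 5p_C w_C = 2e_m` (FGT row). [folklore] -/
theorem leak_rows_system (m : ℕ) :
    4 * leakMassA m - 5 * leakMassC m = 2 ∧ 4 * leakMassA m * wA - 5 * leakMassC m * wC = 2 * leakE m := by
  have hΔ : wC - wA ≠ 0 := (sub_pos.2 wA_lt_wC).ne'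
  refine ⟨by unfold leakMassA; ring, ?_⟩
  have hC : 5 * leakMassC m * (wC - wA) = 2 * (wA - leakE m) := by
    unfold leakMassC; field_simp
  unfold leakMassA
  linear_combination (-1 : ℝ) * hC

/-- `p_B (m+2)² = 1/8`. [folklore] -/
theorem leakMassB_mul_sq (m : ℕ) : leakMassB m * ((m + 2 : ℕ) : ℝ) ^ 2 = 1 / 8 := by
  unfold leakMassB
  have : ((m + 2 : ℕ) : ℝ) ≠ 0 := by positivity
  field_simp

end Weights

end

end Summit.AnomalousDissipation.AnomalousDissipation.Theorems.UniformResolution.Negative
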